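import Summits.ResolutionOfSingularities.ResolutionOfSingularities.Theorems.PurelyInseparableDim4NearDimConverse
import HarnessLib

/-!
# [OURS · res-dim4-pi PR-3d] The converse of PR-3 for an ARBITRARY coordinate centre `C_S` (MODE 1h / 2
  edges): over an infinite field, a clean state with `q ≤ ord_{C_S} F < 2q` has a NON-equimultiple point
  in every chart `x_j`, `j ∈ S` — so `near_dim = n − 1 ⟺ ord_{C_S} F ≥ 2q`

Cell `res-dim4-pi` (D-0157 DOOR 2), seat `res-dim4-p-3`; sequel of `PurelyInseparableDim4NearDimConverse.lean`
(the point centre `S = univ`).  The engines' edges are mostly coordinate centres of positive dimension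
(MODE 1h: smallest `|S|` with `q ≤ ord_{(x_S)} F`), so the LOCUS flag needs the centre version: the
`S`-INITIAL FORM `F_{S,m} = Σ_{Σ_{i∈S} dᵢ = m} c_d x^d` (`m = ord_{C_S} F`) replaces the initial form, the
`S`-scaling `x_i ↦ c·x_i (i ∈ S)` replaces the homothety, everything else is as for the point.

## What is proved (`K` a field, `σ` finite, `s : CState σ K`, centre `S`, chart `j ∈ S`, `b_j = 0`, the
## other coordinates of `b` free — translations along the centre included)

* §1 `eval_scale_of_forall_degIn_eq` (`S`-homogeneous `Φ` of `S`-degree `k`: `Φ(c·_S x) = cᵏ Φ(x)`),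
  `eq_zero_of_forall_degIn_eq_of_forall_eval_update` (infinite `K`, `j ∈ S`: vanishing on `{x_j = 1}`
  forces `Φ = 0`), `degIn_eq_of_mem_support_pderiv` (`S`-degree of `∂ᵢΦ`).
* §2 **`coeff_add_single_pointTransform`** — the layer identity for `C_S`: if every monomial of `F` has
  `S`-degree `≥ m ≥ q` then `coeff (γ + (m−q)e_j) (pointTransform q S j b s) = coeff γ (F_{S,m}(U + b̂))`
  (`γ_j = 0`, `b̂_j = 1`).
* §3 **`exists_not_isEquimultiplePoint_centre_of_lt_two_mul`** (`q < ord_S F < 2q`, infinite `K`) and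
  **`exists_not_isEquimultiplePoint_centre_of_ordAlong_eq`** (`ord_S F = p = char K`, `F` clean, infinite `K`):
  a non-near point in every chart `j ∈ S`.
* §4 **`forall_isEquimultiplePoint_centre_iff_two_mul_le_ordAlong`**: for a clean state, a Hironaka-
  permissible `S` (`p ≤ ord_S F`), `j ∈ S`, infinite `K` of characteristic `p`: «every `b` with `b_j = 0` is
  near» `⟺ 2p ≤ ord_{C_S} F` (⇐ is PR-3's `isEquimultiplePoint_of_two_mul_le_ordAlong`, any ring).

[OURS · counted 0 · elementary; AI kernel work, weaker than expert review.]  Geometric-points statement.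
Nothing here is a statement about resolution of singularities; resolution in dimension `≥ 4` /
characteristic `p > 0` is NOT proved by anything in this file.  Host item (DR-157-C):
`stmt-ResolutionOfSingularities-16155`, helper.
-/

noncomputable section

set_option linter.dupNamespace false -- mandated namespace of this single-conjunct summit

open MvPolynomial Finset
open scoped BigOperators

namespace Summit.ResolutionOfSingularities.ResolutionOfSingularities.Theorems.PIDim4.NearDim

open Literature.AlgebraicGeometry.Resolution
open Literature.AlgebraicGeometry.Resolution.CentreBlowup
open Literature.AlgebraicGeometry.Resolution.Hauser2010

variable {σ : Type*} {K : Type*} [Field K] [Fintype σ] [DecidableEq σ]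

/-! ## §1 `S`-homogeneous polynomials -/

/-- **`S`-scaling.** If every monomial of `Φ` has `S`-degree `k`, then
`Φ(c·x_S, x_{σ∖S}) = cᵏ·Φ(x)`. OURS (bookkeeping). [folklore] -/
theorem eval_scale_of_forall_degIn_eq {S : Finset σ} {Φ : MvPolynomial σ K} {k : ℕ}
    (hΦ : ∀ d ∈ Φ.support, degIn S d = k) (c : K) (x : σ → K) :
    eval (fun i => if i ∈ S then c * x i else x i) Φ = c ^ k * eval x Φ := by
  rw [MvPolynomial.eval_eq', MvPolynomial.eval_eq', Finset.mul_sum]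
  refine Finset.sum_congr rfl fun d hd => ?_
  have hprod : (∏ i, (fun i => if i ∈ S then c * x i else x i) i ^ d i) =
      c ^ k * ∏ i, x i ^ d i := by
    have h1 : ∀ i, (fun i => if i ∈ S then c * x i else x i) i ^ d i =
        (if i ∈ S then c ^ d i else 1) * x i ^ d i := by
      intro i
      by_cases hi : i ∈ S
      · simp only [hi, if_true, mul_pow]
      · simp only [hi, if_false, one_mul]
    simp_rw [h1]
    rw [Finset.prod_mul_distrib, Finset.prod_ite, Finset.prod_const_one, mul_one,
      Finset.prod_pow_eq_pow_sum]
    congr 2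
    rw [← hΦ d hd]
    unfold degIn
    exact Finset.sum_congr (by ext i; simp) fun _ _ => rfl
  rw [hprod]
  ring

/-- **An `S`-homogeneous polynomial vanishing at every point with `x_j = 1` (`j ∈ S`) of an infinite field
is zero** (scale the `S`-coordinates: it vanishes wherever `x_j ≠ 0`, so `Φ·X_j ≡ 0`). OURS (elementary). [folklore] -/
theorem eq_zero_of_forall_degIn_eq_of_forall_eval_update [Infinite K] {S : Finset σ}
    {Φ : MvPolynomial σ K} {k : ℕ} (hΦ : ∀ d ∈ Φ.support, degIn S d = k) {j : σ} (hj : j ∈ S)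
    (h : ∀ b : σ → K, eval (Function.update b j 1) Φ = 0) : Φ = 0 := by
  have hX : Φ * X j = 0 := by
    apply MvPolynomial.funext
    intro w
    rw [map_mul, eval_X, map_zero]
    by_cases hw : w j = 0
    · rw [hw, mul_zero]
    · -- `w = (w_j ·_S y)` with `y = update ((w_j⁻¹) ·_S w) j 1`
      set y : σ → K := Function.update (fun i => if i ∈ S then (w j)⁻¹ * w i else w i) j 1 with hy
      have hscale : w = fun i => if i ∈ S then w j * y i else y i := by
        funext i
        by_cases hij : i = j
        · subst hij; simp [hy, hj]
        · by_cases hi : i ∈ S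
          · simp [hy, Function.update_of_ne hij, hi, hw]
          · simp [hy, Function.update_of_ne hij, hi]
      rw [hscale, eval_scale_of_forall_degIn_eq hΦ, h, mul_zero, zero_mul]
  rcases mul_eq_zero.mp hX with h0 | h0
  · exact h0
  · exact absurd h0 (X_ne_zero j)

omit [Fintype σ] in
/-- **`S`-degree of a partial derivative**: a monomial `x^t` of `∂ᵢΦ` comes from the monomial `x^{t + eᵢ}`
of `Φ`, so `degIn S t + [i ∈ S] = degIn S (t + eᵢ)`. OURS (bookkeeping; tree `WeightedBlowup.coeff_pderiv_eq`). [folklore] -/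
theorem degIn_eq_of_mem_support_pderiv {S : Finset σ} {Φ : MvPolynomial σ K} {k : ℕ}
    (hΦ : ∀ d ∈ Φ.support, degIn S d = k) (i : σ) {t : σ →₀ ℕ} (ht : t ∈ (pderiv i Φ).support) :
    degIn S t = k - (if i ∈ S then 1 else 0) ∧ (i ∈ S → 1 ≤ k) := by
  have hc := WeightedBlowup.coeff_pderiv_eq i Φ t
  have hmem : t + Finsupp.single i 1 ∈ Φ.support := by
    rw [mem_support_iff]
    intro h0
    rw [h0, mul_zero] at hc
    exact (mem_support_iff.mp ht) hc
  have hdeg := hΦ _ hmem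
  rw [degIn_add, degIn_single] at hdeg
  by_cases hi : i ∈ S
  · rw [if_pos hi] at hdeg; rw [if_pos hi]; exact ⟨by omega, fun _ => by omega⟩
  · rw [if_neg hi] at hdeg; rw [if_neg hi]; exact ⟨by omega, fun h => absurd h hi⟩

/-! ## §2 The layer identity for a coordinate centre -/

/-- **The layer identity for `Bl_{C_S}`.** If every monomial of `F` has `S`-degree `≥ m` and `q ≤ m`, then
at `b` with `b_j = 0` in the chart `x_j`, for every `γ` with `γ_j = 0`:
`coeff (γ + (m−q)e_j) (pointTransform q S j b s) = coeff γ (F_{S,m}(U + b̂))`, where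
`F_{S,m} = Σ_{degIn S d = m} c_d x^d` is the `S`-initial form and `b̂ = b` with `b̂_j := 1`.
(Only `S`-degree-`m` monomials reach `x_j`-exponent `m − q`; on them the chart substitution followed by
reading off `x_j^{m−q}` is `x_j := 1` followed by the translation.) OURS.
[cite: HauserPerlega2019PRIMS, §2 (the blowup in the x₁-chart)] -/
theorem coeff_add_single_pointTransform {q m : ℕ} (hqm : q ≤ m) (S : Finset σ) (j : σ) (b : σ → K)
    (hbj : b j = 0) (s : CState σ K) (hm : ∀ d ∈ s.F.support, m ≤ degIn S d) (γ : σ →₀ ℕ)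
    (hγ : γ j = 0) :
    coeff (γ + Finsupp.single j (m - q)) (pointTransform q S j b s) =
      coeff γ (PointBlowup.translate (Function.update b j 1)
        (∑ d ∈ s.F.support with degIn S d = m, monomial d (coeff d s.F))) := by
  have hsum : pointTransform q S j b s = ∑ d ∈ s.F.support,
      PointBlowup.translate b (monomial (chartExponent q S j d) (coeff d s.F)) := by
    unfold pointTransform chartTransform PointBlowup.translate
    rw [map_sum]
  have hinit : PointBlowup.translate (Function.update b j 1)
      (∑ d ∈ s.F.support with degIn S d = m, monomial d (coeff d s.F)) =
      ∑ d ∈ s.F.support with degIn S d = m,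
        PointBlowup.translate (Function.update b j 1) (monomial d (coeff d s.F)) := by
    unfold PointBlowup.translate
    rw [map_sum]
  rw [hsum, hinit, coeff_sum, coeff_sum, Finset.sum_filter]
  refine Finset.sum_congr rfl fun d hd => ?_
  rw [WeightedBlowup.coeff_translate_monomial, WeightedBlowup.coeff_translate_monomial,
    ← Finset.mul_prod_erase Finset.univ _ (Finset.mem_univ j),
    ← Finset.mul_prod_erase Finset.univ _ (Finset.mem_univ j)]
  have hrest : ∏ i ∈ Finset.univ.erase j,
      (((chartExponent q S j d i).choose ((γ + Finsupp.single j (m - q)) i) : K) *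
        b i ^ (chartExponent q S j d i - (γ + Finsupp.single j (m - q)) i)) =
      ∏ i ∈ Finset.univ.erase j, (((d i).choose (γ i) : K) *
        Function.update b j 1 i ^ (d i - γ i)) := by
    refine Finset.prod_congr rfl fun i hi => ?_
    have hij : i ≠ j := Finset.ne_of_mem_erase hi
    rw [chartExponent_apply_of_ne q _ hij, Finsupp.add_apply, Finsupp.single_eq_of_ne hij, add_zero,
      Function.update_of_ne hij]
  have hj1 : (((chartExponent q S j d j).choose ((γ + Finsupp.single j (m - q)) j) : ℕ) : K) *
      b j ^ (chartExponent q S j d j - (γ + Finsupp.single j (m - q)) j) =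
      if degIn S d = m then 1 else 0 := by
    rw [chartExponent_apply_self, Finsupp.add_apply, hγ, zero_add, Finsupp.single_eq_same, hbj]
    by_cases hdeg : degIn S d = m
    · rw [if_pos hdeg, hdeg, Nat.choose_self, Nat.sub_self, pow_zero, Nat.cast_one, one_mul]
    · rw [if_neg hdeg,
        zero_pow (Nat.sub_ne_zero_of_lt (by have := hm d hd; omega)), mul_zero]
  have hj2 : (((d j).choose (γ j) : ℕ) : K) * Function.update b j 1 j ^ (d j - γ j) = 1 := by
    rw [hγ, Function.update_self, Nat.choose_zero_right, Nat.cast_one, one_pow, one_mul]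
  rw [hrest, hj1, hj2, one_mul]
  split_ifs <;> simp

/-! ## §3 `q ≤ ord_{C_S} F < 2q`: a non-near point in every chart `j ∈ S` -/

omit [Fintype σ] [DecidableEq σ] in
/-- From `ord_{C_S} F = m` (finite) to the support form and non-vanishing of the `S`-initial form.
OURS (bookkeeping). [cite: HauserPerlega2019PRIMS, §2 (ord_P)] -/
theorem sInitial_ne_zero_of_ordAlong_eq {S : Finset σ} {F : MvPolynomial σ K} {m : ℕ}
    (hord : ordAlong S F = m) :
    (∀ d ∈ F.support, m ≤ degIn S d) ∧
      (∑ d ∈ F.support with degIn S d = m, monomial d (coeff d F)) ≠ 0 ∧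
      ∀ d ∈ (∑ d ∈ F.support with degIn S d = m, monomial d (coeff d F)).support, degIn S d = m := by
  classical
  have hF : F ≠ 0 := by
    rintro rfl
    rw [ordAlong_zero] at hord
    exact ENat.top_ne_coe m hord
  have hsupp : ∀ d ∈ F.support, m ≤ degIn S d := fun d hd => by
    have := ordAlong_le_of_mem_support (S := S) hd
    rw [hord] at this
    exact_mod_cast this
  -- coefficients of the `S`-initial form
  have hcoeff : ∀ e, coeff e (∑ d ∈ F.support with degIn S d = m, monomial d (coeff d F)) =
      if degIn S e = m then coeff e F else 0 := by
    intro e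
    simp only [coeff_sum, coeff_monomial, Finset.sum_ite_eq', Finset.mem_filter]
    by_cases he : degIn S e = m
    · by_cases hes : e ∈ F.support
      · simp [he, hes]
      · simp [he, notMem_support_iff.mp hes]
    · simp [he]
  refine ⟨hsupp, ?_, fun d hd => ?_⟩
  · obtain ⟨d₀, hd₀, hdeg⟩ := exists_mem_support_ordAlong_eq S hF
    rw [hord] at hdeg
    have hdeg' : degIn S d₀ = m := by exact_mod_cast hdeg.symm
    intro h0
    have := congrArg (coeff d₀) h0
    rw [hcoeff, if_pos hdeg', coeff_zero] at this
    exact (mem_support_iff.mp hd₀) this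
  · have h := mem_support_iff.mp hd
    rw [hcoeff] at h
    by_contra hne
    exact h (if_neg hne)

/-- **`q < ord_{C_S} F < 2q` ⇒ a NON-equimultiple point in every chart `j ∈ S`** (infinite field; no
cleanliness): else the `x_j^{m−q}`-coefficient `F_{S,m}(b̂)` vanishes for all `b̂` with `b̂_j = 1`, forcing
`F_{S,m} = 0`. OURS (elementary). [cite: Hauser2010, §F (equiconstant points)] -/
theorem exists_not_isEquimultiplePoint_centre_of_lt_two_mul [Infinite K] {q m : ℕ} (hqm : q < m)
    (hm2 : m < 2 * q) {S : Finset σ} {j : σ} (hj : j ∈ S) (s : CState σ K)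
    (hord : ordAlong S s.F = m) :
    ∃ b : σ → K, b j = 0 ∧ ¬ IsEquimultiplePoint q S j b s := by
  obtain ⟨hsupp, hne, hhom⟩ := sInitial_ne_zero_of_ordAlong_eq hord
  by_contra hall
  push Not at hall
  apply hne
  refine eq_zero_of_forall_degIn_eq_of_forall_eval_update hhom hj fun b => ?_
  set b₀ : σ → K := Function.update b j 0 with hb₀
  have hb₀j : b₀ j = 0 := by rw [hb₀, Function.update_self]
  have hup : Function.update b₀ j 1 = Function.update b j 1 := by rw [hb₀, Function.update_idem]
  have hcoeff := hall b₀ hb₀j (Finsupp.single j (m - q)) (by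
      rw [Ne, Finsupp.single_eq_zero]; omega) (by rw [Finsupp.degree_single]; omega)
  have hlayer := coeff_add_single_pointTransform hqm.le S j b₀ hb₀j s hsupp 0
    (by rw [Finsupp.coe_zero, Pi.zero_apply])
  rw [zero_add] at hlayer
  rw [hlayer, coeff_zero_translate_eq_eval, hup] at hcoeff
  exact hcoeff

/-- **`ord_{C_S} F = p` and `F` clean ⇒ a NON-equimultiple point in every chart `j ∈ S`** (infinite field of
characteristic `p`): else `∂ᵢF_{S,p}(b̂) = 0` for every `i ≠ j` and every `b̂` (`b̂_j = 1`), so `∂ᵢF_{S,p} = 0`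
(`i ≠ j`; each `∂ᵢF_{S,p}` is `S`-homogeneous), every monomial `x^d` of `F_{S,p}` has `p ∣ dᵢ` for `i ≠ j`,
and `d_j = p − Σ_{i ∈ S∖j} dᵢ` is divisible by `p` too: a `p`-th power monomial of `F`, excluded by the
cleaning. OURS (elementary). [cite: Hauser2010, §G (cleaning) and §F] -/
theorem exists_not_isEquimultiplePoint_centre_of_ordAlong_eq [Infinite K] (p : ℕ) [hp : Fact p.Prime]
    [CharP K p] {S : Finset σ} {j : σ} (hj : j ∈ S) (s : CState σ K) (hord : ordAlong S s.F = p)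
    (hclean : deletePthPowers p s.F = s.F) :
    ∃ b : σ → K, b j = 0 ∧ ¬ IsEquimultiplePoint p S j b s := by
  obtain ⟨hsupp, hne, hhom⟩ := sInitial_ne_zero_of_ordAlong_eq hord
  set L : MvPolynomial σ K := ∑ d ∈ s.F.support with degIn S d = p, monomial d (coeff d s.F) with hL
  by_contra hall
  push Not at hall
  -- (1) all partials off `j` of the `S`-initial form vanish
  have hpd : ∀ i, i ≠ j → pderiv i L = 0 := by
    intro i hij
    have hhom' : ∀ t ∈ (pderiv i L).support, degIn S t = p - (if i ∈ S then 1 else 0) :=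
      fun t ht => (degIn_eq_of_mem_support_pderiv hhom i ht).1
    refine eq_zero_of_forall_degIn_eq_of_forall_eval_update hhom' hj fun b => ?_
    set b₀ : σ → K := Function.update b j 0 with hb₀
    have hb₀j : b₀ j = 0 := by rw [hb₀, Function.update_self]
    have hup : Function.update b₀ j 1 = Function.update b j 1 := by rw [hb₀, Function.update_idem]
    have hcoeff := hall b₀ hb₀j (Finsupp.single i 1) (by rw [Ne, Finsupp.single_eq_zero]; exact one_ne_zero)
      (by rw [Finsupp.degree_single]; exact hp.out.one_lt)
    have hlayer := coeff_add_single_pointTransform le_rfl S j b₀ hb₀j s hsupp (Finsupp.single i 1)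
      (by rw [Finsupp.single_eq_of_ne hij.symm])
    rw [Nat.sub_self, Finsupp.single_zero, add_zero] at hlayer
    rw [hlayer, ← hL, coeff_single_translate_eq_eval_pderiv, hup] at hcoeff
    exact hcoeff
  -- (2) a monomial of the `S`-initial form is a `p`-th power monomial of `F`
  obtain ⟨d₀, hd₀⟩ : ∃ d₀, d₀ ∈ L.support := by
    by_contra hc
    push Not at hc
    exact hne (by ext e; exact notMem_support_iff.mp (hc e))
  have hd₀deg : degIn S d₀ = p := hhom d₀ hd₀
  have hd₀F : coeff d₀ s.F ≠ 0 := by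
    have h := mem_support_iff.mp hd₀
    rw [hL, coeff_sum] at h
    simp_rw [coeff_monomial] at h
    rw [Finset.sum_ite_eq' (s.F.support.filter _) d₀] at h
    split_ifs at h with hmem
    · exact h
    · exact absurd rfl h
  have hdiv : ∀ i, p ∣ d₀ i := by
    have hoff : ∀ i, i ≠ j → p ∣ d₀ i := fun i hij => dvd_of_pderiv_eq_zero p (hpd i hij) hd₀
    intro i
    by_cases hij : i = j
    · subst hij
      have hsum : d₀ i + ∑ k ∈ S.erase i, d₀ k = p := by
        rw [Finset.add_sum_erase _ _ hj]; exact hd₀deg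
      have hrest : p ∣ ∑ k ∈ S.erase i, d₀ k :=
        Finset.dvd_sum fun k hk => hoff k (Finset.ne_of_mem_erase hk)
      have : p ∣ d₀ i + ∑ k ∈ S.erase i, d₀ k := by rw [hsum]
      exact (Nat.dvd_add_right hrest).mp (by rwa [add_comm] at this)
    · exact hoff i hij
  have hP : IsPthPowerExponent p d₀ := fun i _ => hdiv i
  have : coeff d₀ (deletePthPowers p s.F) = 0 := by rw [coeff_deletePthPowers, if_pos hP]
  rw [hclean] at this
  exact hd₀F this

/-! ## §4 The LOCUS flag for coordinate centres as an iff -/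

/-- **Near everywhere in a chart `j ∈ S` forces `ord_{C_S} F ≥ 2p`** (clean state, `S` in the `p`-fold
locus, infinite field of characteristic `p`). OURS (elementary). [cite: Hauser2010, §F (equiconstant points)] -/
theorem two_mul_le_ordAlong_of_forall_isEquimultiplePoint [Infinite K] (p : ℕ) [Fact p.Prime] [CharP K p]
    {S : Finset σ} {j : σ} (hj : j ∈ S) (s : CState σ K) (hclean : deletePthPowers p s.F = s.F)
    (hp : (p : ℕ∞) ≤ ordAlong S s.F) (hall : ∀ b : σ → K, b j = 0 → IsEquimultiplePoint p S j b s) :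
    ((2 * p : ℕ) : ℕ∞) ≤ ordAlong S s.F := by
  by_cases hF : s.F = 0
  · rw [hF, ordAlong_zero]; exact le_top
  obtain ⟨d₀, -, hm⟩ := exists_mem_support_ordAlong_eq S hF
  set m := degIn S d₀
  rw [hm] at hp ⊢
  have hpm : p ≤ m := by exact_mod_cast hp
  by_contra hlt
  have hm2 : m < 2 * p := by
    have := not_le.mp hlt
    exact_mod_cast this
  rcases hpm.eq_or_lt with h | h
  · have hordp : ordAlong S s.F = (p : ℕ∞) := by rw [hm, ← h]
    obtain ⟨b, hbj, hb⟩ := exists_not_isEquimultiplePoint_centre_of_ordAlong_eq p hj s hordp hclean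
    exact hb (hall b hbj)
  · obtain ⟨b, hbj, hb⟩ := exists_not_isEquimultiplePoint_centre_of_lt_two_mul h hm2 hj s hm
    exact hb (hall b hbj)

/-- **`near_dim = n − 1 ⟺ ord_{C_S} F ≥ 2p` for EVERY coordinate centre (PR-3 ∧ PR-3d).** For a CLEAN state,
a centre `S` inside the `p`-fold locus (`p ≤ ord_{C_S} F`, HP condition (1)), a chart `j ∈ S`, over an INFINITE
field of characteristic `p`: every point `b` of the exceptional hyperplane `{x_j = 0}` (all other `b_i` free)
is equimultiple iff `2p ≤ ord_{C_S} F`. (⇐ is PR-3's `isEquimultiplePoint_of_two_mul_le_ordAlong`, any ring.)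
OURS (census: the MODE-1h LOCUS flag on geometric points is exactly PR-3's condition).
[cite: Hauser2010, §F (equiconstant points)] -/
theorem forall_isEquimultiplePoint_centre_iff_two_mul_le_ordAlong [Infinite K] (p : ℕ) [Fact p.Prime]
    [CharP K p] {S : Finset σ} {j : σ} (hj : j ∈ S) (s : CState σ K)
    (hclean : deletePthPowers p s.F = s.F) (hp : (p : ℕ∞) ≤ ordAlong S s.F) :
    (∀ b : σ → K, b j = 0 → IsEquimultiplePoint p S j b s) ↔ ((2 * p : ℕ) : ℕ∞) ≤ ordAlong S s.F :=
  ⟨two_mul_le_ordAlong_of_forall_isEquimultiplePoint p hj s hclean hp,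
    fun h _ hbj => isEquimultiplePoint_of_two_mul_le_ordAlong j hbj h⟩

end Summit.ResolutionOfSingularities.ResolutionOfSingularities.Theorems.PIDim4.NearDim

end
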